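import Summits.QuantumFields.YangMills.Theorems.F4SubCurvatureDoorShortRootRigidityPlanarRigidity
import Mathlib
import HarnessLib

/-!
# Registered vocabulary of SUB-LINE g22-A «HERMITIAN SLICE» — the typed rungs R1–R4 of stub H2 `HermitianPlanarRigidity`
# (planner ym-idea-3 g22; crux ⟨stmt-QuantumFields-23035⟩ `F4SubCurvatureDoor.ShortRootRigidity`, registered stub `:146 stub_oddModeRigidity`)

The tree files `Cruxes/ShortRootRigidity/Lines/hermitian_slice.lean` (commit 7d6b9371ad68) and `Cruxes/ShortRootRigidity/Lines/hermitian_slice_rungs.lean`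
(commit fdd8f4dcefd5) cannot be imported.  This module restates their name-keyed vocabulary CHARACTER-IDENTICALLY (same `open`s and imports;
own namespace `…Theorems.F4SubCurvatureDoorHermitianSliceRegistered`, pattern of ✓`…OddModeSplitRegistered`), so that the four rungs can be landed BY NAME from importable
statements and composed:

* `IsHermitianPlanarLF`, `InHermitianPlanarClass`, `HermitianPlanarRigidity` (H2), `HermitianAngularContinuation`, `ThreeModeOnCircles`;
* the rungs `HermitianCone` (R1), `HermitianAngularRung` (R2), `ThreeModeLaurent` (R3), `BoostPositivityKill` (R4);
* the PROVED composition `threeModeOnCircles_of` and `hermitianPlanarRigidity_of_rungs : R1 → R2 → R3 → R4 → HermitianPlanarRigidity`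
  (verbatim from the rungs file).

Nothing here is registered on the ledger (the sub-line is insurance for `:146`, unstaffed by design); rung proofs land
`--supports stmt-QuantumFields-23035 --as helper`.  Pattern: ✓`…ShortRootRigidityOddModeSplitRegistered`, ✓`…ShortRootRigidityTrigonalDefs`.
Free-hands work of the EXTRA WIDTH seat ym-line-sfw-p2-w4 (gen 25).
HONEST LABEL: vocabulary only — R1–R4, H1–H4, `:146`, ⟨23035⟩, ⟨23125⟩, R2d and the Yang–Mills mass gap are OPEN.  No summit is proved by a line.
-/

noncomputable section

namespace Summit.QuantumFields.YangMills.Theorems.F4SubCurvatureDoorHermitianSliceRegistered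

open scoped Topology BigOperators RealInnerProductSpace
open Filter Set MeasureTheory
open Literature.MathematicalPhysics.QuantumLattice (timeReflection)
open Summit.QuantumFields.YangMills.Theorems.F4SubCurvatureDoorSliceDensityRegistered (E2)
open Summit.QuantumFields.YangMills.Theorems.F4SubCurvatureDoorSliceInClassRegistered (hexReflection InPlanarClass)
open Summit.QuantumFields.YangMills.Theorems.F4SubCurvatureDoorPlanarFrameTimeHolomorphyRegistered (mk2)
open Summit.QuantumFields.YangMills.Theorems.F4SubCurvatureDoorPlanarInitialApertureRegistered (IsPlanarLF HasAperture)
open Summit.QuantumFields.YangMills.Cruxes.ShortRootRigidity.AngularType (polar)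

/-! ## Vocabulary (character-identical with `Lines/hermitian_slice.lean` / `Lines/hermitian_slice_rungs.lean`) -/

/-- `μ` is a frame Laplace–Fourier measure of the complex planar kernel `k` in the frame `e₀`, complex form (verbatim). [problem-side definition] -/
def IsHermitianPlanarLF (k : E2 → ℂ) (μ : Measure (ℝ × ℝ)) : Prop :=
  μ (Set.Iio 0 ×ˢ Set.univ) = 0 ∧
    ∀ t : ℝ, 0 < t → Integrable (fun z : ℝ × ℝ => Real.exp (-(t * z.1))) μ ∧
      ∀ x : ℝ, k (mk2 t x) = ∫ z, ((Real.exp (-(z.1 * t)) : ℝ) : ℂ) * Complex.exp (((z.2 * x : ℝ) : ℂ) * Complex.I) ∂μ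

/-- THE HERMITIAN PLANAR CLASS (verbatim). [problem-side definition] -/
def InHermitianPlanarClass (k : E2 → ℂ) : Prop :=
  ContinuousOn k {y | y ≠ 0} ∧
  (∃ C : ℝ, ∀ y, 1 ≤ ‖y‖ → ‖k y‖ ≤ C) ∧
  (∀ y, k (timeReflection 2 y) = k y) ∧
  (∀ y, k (hexReflection y) = k y) ∧
  (∃ μ : Measure (ℝ × ℝ), IsHermitianPlanarLF k μ) ∧
  Tendsto (fun y : E2 => ‖y‖ ^ 6 * ‖k y‖) (𝓝[≠] 0) (𝓝 0)

/-- **H2 «HERMITIAN PLANAR RIGIDITY»** (verbatim). [problem-side statement] -/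
def HermitianPlanarRigidity : Prop :=
  ∀ k : E2 → ℂ, InHermitianPlanarClass k → ∀ (R : E2 ≃ₗᵢ[ℝ] E2) (y : E2), y ≠ 0 → k (R y) = k y

/-- «HERMITIAN ANGULAR CONTINUATION OF TYPE `(2π/3, 6)`» for one complex planar kernel: on every circle the angular trace is the restriction
of an entire `2π/3`-periodic function of little-o exponential type `6` (the Hermitian sibling of `AngularType.AngularContinuation`, whose period
is `π/3`). [problem-side definition] -/
def HermitianAngularContinuation (k : E2 → ℂ) : Prop :=
  ∀ r : ℝ, 0 < r → ∃ G : ℂ → ℂ, Differentiable ℂ G ∧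
    (∀ φ : ℝ, G φ = k (polar r φ)) ∧
    (∀ z : ℂ, G (z + ((2 * Real.pi / 3 : ℝ) : ℂ)) = G z) ∧
    ∀ δ : ℝ, 0 < δ → ∃ Ψ : ℝ, ∀ φ ψ : ℝ, Ψ ≤ |ψ| → ‖G (φ + ψ * Complex.I)‖ ≤ δ * Real.exp (6 * |ψ|)

/-- «THREE-MODE FORM ON CIRCLES»: every circle trace of `k` is `c₀ + c₊ e^{3iφ} + c₋ e^{−3iφ}`. [problem-side definition] -/
def ThreeModeOnCircles (k : E2 → ℂ) : Prop :=
  ∀ r : ℝ, 0 < r → ∃ c₀ c₁ c₂ : ℂ, ∀ φ : ℝ,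
    k (polar r φ) = c₀ + c₁ * Complex.exp (3 * (φ : ℂ) * Complex.I) + c₂ * Complex.exp (-(3 * (φ : ℂ) * Complex.I))

/-! ## The four rungs -/

/-- **R1 «HERMITIAN CONE»** (S–M): the frame measure of a Hermitian planar kernel has aperture `1` (support in the forward light cone).
Route: `InPlanarClass (Re ∘ k)` + `IsPlanarLF (Re ∘ k) μ` + ✓`planarConeSupport_holds`. [problem-side statement] -/
def HermitianCone : Prop :=
  ∀ (k : E2 → ℂ) (μ : Measure (ℝ × ℝ)), InHermitianPlanarClass k → IsHermitianPlanarLF k μ → HasAperture μ 1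

/-- **R2 «HERMITIAN ANGULAR CONTINUATION»** (M): three rotated frame charts, no conjugation; growth from the real axis majorant and the budget.
[problem-side statement] -/
def HermitianAngularRung : Prop :=
  ∀ (k : E2 → ℂ) (μ : Measure (ℝ × ℝ)), InHermitianPlanarClass k → IsHermitianPlanarLF k μ → HasAperture μ 1 →
    HermitianAngularContinuation k

/-- **R3 «THREE-MODE LAURENT RIGIDITY»** (S–M, one complex variable): entire + `2π/3`-periodic + `o(e^{6|ψ|})` ⇒ three modes.
[problem-side statement] -/
def ThreeModeLaurent : Prop :=
  ∀ G : ℂ → ℂ, Differentiable ℂ G → (∀ z : ℂ, G (z + ((2 * Real.pi / 3 : ℝ) : ℂ)) = G z) →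
    (∀ δ : ℝ, 0 < δ → ∃ Ψ : ℝ, ∀ φ ψ : ℝ, Ψ ≤ |ψ| → ‖G (φ + ψ * Complex.I)‖ ≤ δ * Real.exp (6 * |ψ|)) →
    ∃ c₀ c₁ c₂ : ℂ, ∀ z : ℂ, G z = c₀ + c₁ * Complex.exp (3 * z * Complex.I) + c₂ * Complex.exp (-(3 * z * Complex.I))

/-- **R4 «BOOST-POSITIVITY KILL»** (M–L, the new step): positivity of the Lorentz-boosted frame measures kills the modes `±3`.
WHY IT MIGHT FAIL (formal, not mathematical): the uniqueness theorem for the complex planar Laplace–Fourier transform must be run for SIGNED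
measures (by rearrangement into positive ones) and the boosted measures must be shown to satisfy the integrability conjunct; both routine
on the cone `E ≥ |p|`. [problem-side statement] -/
def BoostPositivityKill : Prop :=
  ∀ (k : E2 → ℂ) (μ : Measure (ℝ × ℝ)), InHermitianPlanarClass k → IsHermitianPlanarLF k μ → HasAperture μ 1 →
    ThreeModeOnCircles k → ∀ (R : E2 ≃ₗᵢ[ℝ] E2) (y : E2), y ≠ 0 → k (R y) = k y

/-! ## Composition (PROVED, verbatim from the rungs file): R1 → R2 → R3 → R4 → H2 -/

/-- R3 applied circle by circle: an angular continuation of type `(2π/3, 6)` is a three-mode trigonometric polynomial on every circle. -/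
theorem threeModeOnCircles_of (r3 : ThreeModeLaurent) {k : E2 → ℂ} (hA : HermitianAngularContinuation k) :
    ThreeModeOnCircles k := by
  intro r hr
  obtain ⟨G, hGd, hGk, hGp, hGg⟩ := hA r hr
  obtain ⟨c₀, c₁, c₂, hc⟩ := r3 G hGd hGp hGg
  exact ⟨c₀, c₁, c₂, fun φ => by rw [← hGk φ]; exact hc φ⟩

/-- H2 from the four rungs. -/
theorem hermitianPlanarRigidity_of_rungs (r1 : HermitianCone) (r2 : HermitianAngularRung) (r3 : ThreeModeLaurent)
    (r4 : BoostPositivityKill) : HermitianPlanarRigidity := by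
  intro k hk R y hy
  obtain ⟨μ, hμ⟩ := hk.2.2.2.2.1
  have hap : HasAperture μ 1 := r1 k μ hk hμ
  exact r4 k μ hk hμ hap (threeModeOnCircles_of r3 (r2 k μ hk hμ hap)) R y hy

end Summit.QuantumFields.YangMills.Theorems.F4SubCurvatureDoorHermitianSliceRegistered

end
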